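import Literature.Computability.Complexity.CircuitLowerBounds
import Literature.Computability.Complexity.CliqueTestGraphs
import Literature.Computability.Complexity.RossmanMonotoneClique
import Literature.Computability.Complexity.CliqueThresholdBounds
import Literature.Computability.Complexity.GnpSprinkling
import Mathlib
import HarnessLib

/-!
# Amplified critical window — typed BASE HELPERS for stub B `CriticalWindowHardness`
(cell pnp-ideate, seat p3, ROUND-11; line `amplified-window` on item stmt-PneNP-19860; FRONTIER rung F-N1).

This module imports NO `Theses` file (21-frontier build rule 2026-08-26T18:52:29Z): it states, over
Literature declarations only, the four elementary probability facts from which stub B is assembled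
(card HOME/pnp-ideate-p3/r11/amplified-window.md §5 (a)–(f)):

* `SizeBiasIdentity`      — `E[N_k(G)·F(G)] = C(n,k)·p^{C(k,2)}·E_A E_G[F(G ∪ K_A)]` (polynomial identity in `p`);
* `CriticalSecondMoment`  — `E[N_k²] ≤ λ + λ² + K₂/n` for `p ≤ b·n^{-2/(k-1)}` (λ = C(n,k)p^{C(k,2)});
* `LadderBalance`         — IVT: some start density `p₀` makes the sprinkling ladder exactly half-balanced;
* `RungStep`              — the per-rung inequality `1 − √M·√err(p)/λ ≤ θ + π(p ⊕ q) + err(p ⊕ q)` for ANY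
  Boolean `g` satisfying the pointwise relative sparse-noise bound (the conclusion of the tree's PROVED
  `thm1_sparse_relative`) — size-bias + Cauchy–Schwarz below, union law `sum_sum_gnpWeight_mul_sup` above.

Statements only (`def … : Prop`), VERBATIM from the planner's typed file HOME/pnp-ideate-p3/r11/base-helpers.lean
(pnp-ideate-p3 g11, sha 389f8358, evidence #19 on stmt-PneNP-19860), landed by the cell's prover so that the
`theorem …_holds` files (Theorems/NegLimitedAmplifiedWindowBase*.lean) and the referee's 3-day test share one
copy; this module never imports the route file.

HONEST FRAMING: statements, not theorems; they are the planned inputs of the OPEN stub B of a line on an open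
door item; FRONTIER rung F-N1 — nothing here bears on P vs NP.
-/

set_option linter.dupNamespace false -- `Summit.PneNP.PneNP.…`: summit = sub-problem name (D-0017 single-conjunct layout)

namespace Summit.PneNP.PneNP.Theorems.NegLimitedDoor.AmplifiedWindowBase

open Finset
open Literature.Computability.Complexity

/-- Size-bias identity (H1, S–M): for every real `p`, every `k` and every real-valued graph functional `F`,
`p^{C(k,2)} · Σ_{|A|=k} E_{G(n,p)}[F(G ∪ K_A)] = E_{G(n,p)}[N_k(G)·F(G)]`.  Proof: for `x ⊇ K_A` the fibre
`{y : y ∪ K_A = x}` has total weight `gnpWeight n p x / p^{C(k,2)}` (binomial theorem on the `C(k,2)` edges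
inside `A`), and `N_k(x) = #{A : K_A ⊆ x}`. (folklore; Rossman 2010 §2) -/
def SizeBiasIdentity : Prop :=
  ∀ (n k : ℕ) (p : ℝ) (F : ((⊤ : SimpleGraph (Fin n)).edgeSet → Bool) → ℝ),
    p ^ k.choose 2 * ∑ A ∈ powersetCard k (univ : Finset (Fin n)), ∑ x, gnpWeight n p x * F (x ⊔ cliqueVec A) =
      ∑ x, gnpWeight n p x * ((cliqueCount n k x : ℝ) * F x)

/-- Critical second moment (H2, M): below `b` times the clique threshold density, `E[N_k²] ≤ λ + λ² + K₂/n`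
with `λ = C(n,k) p^{C(k,2)}` and `K₂ = K₂(k,b)`.  Proof: `E[N_k²] = Σ_{A,B} p^{2C(k,2) − C(|A∩B|,2)}`; the pairs
with `|A ∩ B| ≤ 1` give `≤ λ²`, the diagonal gives `λ`, and for `2 ≤ j ≤ k−1` the `j`-overlap term is
increasing in `p` and at `p = b n^{-2/(k-1)}` equals `O_{k,b}(n^{-j(k-j)/(k-1)}) ≤ O_{k,b}(1/n)` (cf. the
tree's `sum_erase_pow_inter_le`). (folklore; Bollobás–Erdős 1976; Rossman 2010 App. B) -/
def CriticalSecondMoment : Prop :=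
  ∀ k : ℕ, 2 ≤ k → ∀ b : ℝ, 1 ≤ b → ∃ K₂ : ℝ, 0 ≤ K₂ ∧ ∀ n : ℕ, 1 ≤ n → ∀ p : ℝ, 0 ≤ p → p ≤ 1 →
    p ≤ b * (n : ℝ) ^ (-(2 : ℝ) / ((k : ℝ) - 1)) →
      ∑ x, gnpWeight n p x * (cliqueCount n k x : ℝ) ^ 2 ≤
        (n.choose k : ℝ) * p ^ k.choose 2 + ((n.choose k : ℝ) * p ^ k.choose 2) ^ 2 + K₂ / n

/-- Ladder balance (H4, S): the sprinkling ladder `p_i(p₀) = 1 − (1 − p₀)(1 − s)^i` (`= p₀ ⊕ (1 − (1−s)^i)`),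
`i < T`, started at `p₀ = 0` has mean clique probability `≤ 1/2` (hypothesis) and at `p₀ = 1` has mean `1`
(`k ≤ n`); by the intermediate value theorem (each `gnpProb` is a polynomial in `p₀`) some `p₀ ∈ [0,1]`
balances it exactly (folklore). -/
def LadderBalance : Prop :=
  ∀ (n k T : ℕ) (s : ℝ), k ≤ n → 0 < T → 0 ≤ s → s ≤ 1 →
    ∑ i ∈ range T, gnpProb n (1 - (1 - s) ^ i) (univ.filter fun x => 1 ≤ cliqueCount n k x) ≤ T / 2 →
    ∃ p₀ : ℝ, 0 ≤ p₀ ∧ p₀ ≤ 1 ∧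
      ∑ i ∈ range T, gnpProb n (1 - (1 - p₀) * (1 - s) ^ i) (univ.filter fun x => 1 ≤ cliqueCount n k x) =
        T / 2

/-- The per-rung inequality (H5 = the heart of B, M–L): for ANY Boolean graph function `g` obeying the
pointwise relative sparse-noise bound with noise density `q` and slack `θ` (this is the shape of the
conclusion of the tree's PROVED `thm1_sparse_relative`, with `θ = η + exp(−n^{δ/2})`, `q = n^{−ρ}`), and any
second-moment bound `E_p[N_k²] ≤ M` with `λ = C(n,k)p^{C(k,2)} > 0`:
`1 − (√M/λ)·√(err_p) ≤ θ + π(p ⊕ q) + err_{p ⊕ q}`, where `err_r = Pr_{G(n,r)}[g ≠ CLIQUE_k]` and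
`π(r) = Pr_{G(n,r)}[CLIQUE_k]`.  Below: size-bias identity + Cauchy–Schwarz (`E[N_k·(1−g)] ≤ √(E N_k²)·√err_p`,
since `N_k ≥ 1 ∧ g = 0 ⇒ g ≠ CLIQUE_k`); above: average the pointwise bound over `x ~ G(n,p)` and use the union
law `sum_sum_gnpWeight_mul_sup` (`G(n,p) ∪ G(n,q) ~ G(n, p ⊕ q)`), then `g = 1 ⇒ CLIQUE_k ∨ g ≠ CLIQUE_k`.
(this cell; ingredients Rossman 2010 §2/App. B, CCC'15 Lemma 1.3 context) -/
def RungStep : Prop :=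
  ∀ (n k : ℕ) (p q θ M : ℝ) (g : ((⊤ : SimpleGraph (Fin n)).edgeSet → Bool) → Bool),
    0 ≤ p → p ≤ 1 → 0 ≤ q → q ≤ 1 → 0 < (n.choose k : ℝ) * p ^ k.choose 2 → 0 ≤ M →
    (∀ x, kSubsetProb n k (fun A => g (x ⊔ cliqueVec A) = true) ≤
        θ + gnpProb n q (univ.filter fun y => g (x ⊔ y) = true)) →
    ∑ x, gnpWeight n p x * (cliqueCount n k x : ℝ) ^ 2 ≤ M →
      1 - Real.sqrt M / ((n.choose k : ℝ) * p ^ k.choose 2) *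
            Real.sqrt (gnpProb n p (univ.filter fun x => g x ≠ cliqueFn n k x)) ≤
        θ + gnpProb n (p + q - p * q) (univ.filter fun x => cliqueFn n k x = true) +
          gnpProb n (p + q - p * q) (univ.filter fun x => g x ≠ cliqueFn n k x)

end Summit.PneNP.PneNP.Theorems.NegLimitedDoor.AmplifiedWindowBase
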